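import Literature.AlgebraicGeometry.Frobenioids.PerfectionFrobeniusCompactDescent
import Literature.AlgebraicGeometry.Frobenioids.Thm42SubAssemblyIGeneral
import Literature.AlgebraicGeometry.Frobenioids.UnitTrivialModelType
import Literature.AlgebraicGeometry.Frobenioids.BirationalizationFrobenioidGeneral
import HarnessLib

/-!
# Frobenioids I: the perfection of a Frobenioid of unit-trivial type is of unit-trivial type; hence the
# birationalization of the perfection of a unit-trivial isotropic Frobenioid is a Frobenioid

Mochizuki, *The geometry of Frobenioids I: the general theory*, Kyushu J. Math. **62** (2008)
293–400: Prop. 3.2 (ii) p. 58 ("a morphism of `C^pf` is an isomorphism … if and only if the transports of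
[a representative] to all sufficiently large levels are isomorphisms"), Def. 1.2 (iv) p. 23 (unit-trivial),
and the author's *Comments* (Jan. 2024) item (29)(v) on the proof of Cor. 4.11 (ii): "by assertion (i), we
may assume without loss of generality that `C` is of unit-trivial, hence also [cf. Proposition 4.4, (iii)]
birationally Frobenius-normalized type" — the property under which `C^birat` is a Frobenioid (Prop. 4.4 (ii)
as amended by item (29)(i)) [cite: MochizukiFrdI2008, Prop. 3.2 (ii) p.58].

PROOF-ONLY file (seat abc-iut-L1-d6, cell sub-DAG S2 `plan/L1/SUBDAG-FrdI-Cor411.md`; the input of the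
unit-trivialization floor of Cor. 4.11 (ii)). For THE perfection `C^pf` (`PreFrobenioid.Perfection`,
`Perfection.ops`, seat abc-iut-L1-d9 lineage):
* `Perfection.isUnitTrivial_of_isOfUnitTrivialType` — if `C` is of unit-trivial type then every object
  `(A, n)` of `C^pf` is unit-trivial: a unit `u` of `(A, n)` is the class of an ISOMORPHISM `θ` of some
  Frobenius power `A^{(c)}` (Prop. 3.2 (ii), `exists_isIso_endClass_eq_descent`, seat abc-iut-L1 lineage), whose
  base is that of `u` conjugated by `Base(A → A^{(c)})`, hence trivial, and whose Frobenius degree is `1`; so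
  `θ ∈ O^×(A^{(c)}) = {1}` and `u = [id] = id`;
* `Perfection.birat_isFrobenioid_of_isOfUnitTrivialType` — for a Frobenioid of isotropic and unit-trivial type
  whose perfection is a Frobenioid (Prop. 3.2 (iii), hypothesis `hPf`), the birationalization
  `(C^pf)^birat → F_{0_D}` is a Frobenioid: `C^pf` is isotropic (seat abc-iut-w5 lineage,
  `isOfIsotropicType_toFunctor`) and unit-trivial, hence birationally Frobenius-normalized (Thm. 5.1 (iv) /
  Prop. 4.4 (iii): `isBiratFrobeniusNormalized_of_isOfUnitTrivialType`, seat abc-iut-L6 lineage), and Prop. 4.4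
  (ii) in its amended generality (`Birat.isFrobenioid_general`, seat abc-iut-w5 lineage) applies.
No new definitions; nothing of the paper is restated; nothing here is specific to the abc programme.
-/

namespace Literature.AlgebraicGeometry.Frobenioids

open CategoryTheory Opposite

universe w v v' u u'

namespace PreFrobenioid

namespace Perfection

variable {D : Type u} [Category.{v} D] {Φ : Dᵒᵖ ⥤ CommMonCat.{w}}
  {C : Type u'} [Category.{v'} C] {F : C ⥤ ElemFrobenioid Φ} {hF : IsFrobenioid F}

/-- **The perfection of a Frobenioid of unit-trivial type is of unit-trivial type** (Prop. 3.2 (ii):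
an automorphism of `(A, n)` in `C^pf` is the class of an isomorphism `θ` of some `A^{(c)}`; a unit has
trivial base and Frobenius degree `1`, so `θ ∈ O^×(A^{(c)})`, which is trivial).
[cite: MochizukiFrdI2008, Prop. 3.2 (ii) p.58] -/
theorem isUnitTrivial_of_isOfUnitTrivialType (hut : IsOfType (IsUnitTrivial F)) (X : Perfection hF) :
    IsUnitTrivial (Perfection.ops hF).toFunctor X := by
  intro u hu
  obtain ⟨hb, hl⟩ := hu
  obtain ⟨c, θ, hθ, hcl⟩ := exists_isIso_endClass_eq_descent X u.hom
  haveI := hθ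
  -- the base of `θ`: `Base(frob) ≫ Base(θ) ≫ Base(frob)⁻¹ = Base[u] = id`
  have h1 : Hom.baseMap u.hom = 𝟙 _ := hb
  rw [← hcl, baseMap_endClass] at h1
  have hbθ : Base F θ = 𝟙 _ := by
    calc Base F θ
        = (baseInvFrob hF X.obj c ≫ Base F (frob hF X.obj c)) ≫ Base F θ ≫
            (baseInvFrob hF X.obj c ≫ Base F (frob hF X.obj c)) := by
          rw [baseInvFrob_base_frob, Category.id_comp, Category.comp_id]
      _ = baseInvFrob hF X.obj c ≫ (Base F (frob hF X.obj c) ≫ Base F θ ≫ baseInvFrob hF X.obj c) ≫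
            Base F (frob hF X.obj c) := by simp only [Category.assoc]
      _ = 𝟙 _ := by rw [h1, Category.id_comp, baseInvFrob_base_frob]
  -- the Frobenius degree of `θ` is that of `u`, i.e. `1`
  have hlθ : degFr F θ = 1 := by
    have h2 : Hom.degFr u.hom = 1 := hl
    rw [← hcl] at h2
    exact h2
  -- so `θ` is a unit of `A^{(c)}`, hence trivial
  have hunit : asIso θ ∈ unitsSubgroup F (frobPow hF X.obj c) := ⟨hbθ, hlθ⟩
  have hθ1 : θ = 𝟙 _ := by
    have h := congrArg Iso.hom (hut _ (asIso θ) hunit)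
    rw [asIso_hom] at h
    exact h
  apply Iso.ext
  change u.hom = 𝟙 X
  rw [← hcl, hθ1, endClass_id]

/-- The perfection of a Frobenioid of unit-trivial type is of unit-trivial type.
[cite: MochizukiFrdI2008, Prop. 3.2 (ii) p.58] -/
theorem isOfUnitTrivialType_toFunctor (hut : IsOfType (IsUnitTrivial F)) :
    IsOfType (IsUnitTrivial (Perfection.ops hF).toFunctor) :=
  fun X => isUnitTrivial_of_isOfUnitTrivialType hut X

/-- **The birationalization of the perfection of a unit-trivial isotropic Frobenioid is a Frobenioid**
(author's Comments (2024) item (29): `C^birat` is a Frobenioid for `C` of birationally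
Frobenius-normalized type; unit-trivial + isotropic ⇒ birationally Frobenius-normalized, Thm. 5.1 (iv) /
Prop. 4.4 (iii)) — GIVEN that the perfection `C^pf → F_{Φ^pf}` is a Frobenioid (Prop. 3.2 (iii), `hPf`).
[cite: MochizukiFrdI2008, Prop. 4.4 (ii) p.83] -/
theorem birat_isFrobenioid_of_isOfUnitTrivialType (hF : IsFrobenioid F)
    (hPf : IsFrobenioid (Perfection.ops hF).toFunctor) (hiso : IsOfIsotropicType F)
    (hut : IsOfType (IsUnitTrivial F)) :
    IsFrobenioid (Birat.toElemZero hPf (hasBiratSquares_of_isFrobenioid hPf)) :=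
  Birat.isFrobenioid_general hPf _ fun A =>
    isBiratFrobeniusNormalized_of_isOfUnitTrivialType _ hPf _
      (isOfIsotropicType_toFunctor hF (FrdI.T42.isFrobeniusIsotropic_of_isOfIsotropicType hF hiso))
      (isOfUnitTrivialType_toFunctor (hF := hF) hut) A

end Perfection

end PreFrobenioid

end Literature.AlgebraicGeometry.Frobenioids
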